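import Literature.MathematicalPhysics.QuantumFieldTheory.Balaban1983to89.B11Eq143LinearTermRadii

/-!
# `Balaban1983to89.B11Eq143LinearTermRadiiUniform` — T. Bałaban, *The variational problem and background fields in renormalization group method
# for lattice gauge theories*, Commun. Math. Phys. **102** (1985) 277–309 [Balaban1985Variational], Prop. 6 (117)–(121) p. 295 with the kept
# linear term of (143) p. 300 (*«Proposition 6 is valid for it also»*): THE RADII OF A REGIME WITH A STRICTLY CONTRACTING LINEAR TERM DEPEND ON THE
# OPERATORS ONLY THROUGH THEIR BOUNDS — the radii of `B11Eq143LinearTermRadii.exists_regime_radii_linear_of_le` in CLOSED FORM from the numbers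
# `(B₀, θ, C₄, a₃, δ)`, hence ONE set of radii for EVERY `(𝒢, Λ, W)` under the bounds `‖𝒢f‖ ≤ B₀‖f‖`, `‖ΛY‖ ≤ θ‖Y‖` (`θ < 1`), `W`
# quadratic-analytic with `(C₄, a₃)` — the `Λ ≠ 0` twin of NE9 leaf-01's `B11Eq118RegimeRadiiUniform.regime_explicit`

statement-level skeleton of published theorems with citation tags; proofs where landed; nothing here is a claim about the Yang–Mills mass gap

THE PRINT (loci only).  Prop. 6 (118) «B₀|J|₍₋₃₎ + B₀C₄(ε₄ + a)² ≤ ε₄», (121) «2(ε₄ + a) ≤ a₃, 4B₀C₄(ε₄ + a) < 1» (p. 295); (143) p. 300 keeps a linear term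
`Λ` («Proposition 6 is valid for it also») — then (118) carries `θ(ε₄ + a)` and (121) carries `θ +` (the cell's `B11Eq174Chart.Regime` structure).

WHY THIS FILE (cell context).  The NE9 chain's one-instance chart of `cur U` (leaf-05's `Support/NE9CurChartOneInstance(SmallField)`, desk T23∕T24)
places the J-79 term in the linear slot `Λ := −(𝔊(U) ∘L L_J)` and chooses its radii PER BACKGROUND `U` by `exists_regime_radii_linear` (`B₀ := ‖𝔊(U)‖`,
`θ := ‖Λ‖`).  The OWNER t4-ne9-p1 g81's build ((N) transformation norms, (K) uniform `‖H₁(U)‖`, `‖𝔊(U)‖` over the small-field set, S v1.4) and NE9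
leaf-01's `B11Eq118RegimeRadiiUniform` (radii BEFORE `(𝒢, H, H₁)` under bounds, `Λ = 0`) move the radii BEFORE `∀ U`; for the `Λ ≠ 0` face the
missing brick is the closed form below: given uniform `B₀ ≥ ‖𝔊(U)‖` and a displayed uniform `θ̄ ≥ ‖𝔊(U) ∘L L_J‖`, `θ̄ < 1`, the SAME `(j₀, a, ε₄)` serve
every `U` — across the `U`-indexed carriers `Space115 … (nabla115 η U)` (which is why the radii are written out, not produced by an `∃` per type).

WHAT IS PROVED (sorry-free; 0 `def`; no inequality of the paper asserted as a hypothesis-free fact about its objects).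
* §1 `min3_pos`, `radiiLinear_add_le` — positivity and the cap `ε₄ + a ≤ δ` of the closed-form radii
  `ε₄ := min (a₃∕4) (min (δ∕2) ((1 − θ)∕(16(B₀C₄ + 1))))`, `a := (1 − θ)·ε₄∕(4(θ + 1))`, `j₀ := (1 − θ)·ε₄∕(4(B₀ + 1))`.
* §2 **`regime_linear_explicit`**: for EVERY `𝒢`, `Λ`, `W` with `‖𝒢f‖ ≤ B₀‖f‖`, `‖ΛY‖ ≤ θ‖Y‖` (`0 ≤ θ < 1`), `QuadAnalytic W C₄ a₃`, and every
  `j ≤ j₀`: `Regime 𝒢 Λ W B₀ θ C₄ a₃ j a ε₄` at the closed-form radii (the arithmetic of `exists_regime_radii_linear_of_le` with `B₀` a LETTER).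
* §3 **`exists_regime_radii_linear_uniform`** (fixed carriers): `∃ j₀ a ε₄ > 0`, `ε₄ + a ≤ δ`, BEFORE `∀ 𝒢 Λ W` under the bounds — the quantifiers of
  `exists_regime_radii_linear_of_le` COMMUTED.
MODEL ∕ HONEST SCOPE.  Abstract complex normed spaces and continuous linear maps, as in `B11Eq174Chart`; real arithmetic + quantifier bookkeeping; the
bounds `B₀`, `θ` stay LETTERS (print's (46)∕(117) constants and [5] Thms 3.12∕3.13 are NOT here); NOT print's thresholds verbatim; NOT summit progress
(cell pub-balaban: NE9 NOT PRINTED ∕ NOT PROVED; «NE9 ⇐ the named binders»; spine PROVED 0∕9; HONEST DEPENDENCY: continuum YM on T⁴ ⇐ BetaPertH ∧ nine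
spine estimates (0/9 proved); BetaPertH ⇐ (D1) ∧ (D4) ∧ CAP+tail; G-an2-4 gates asym, D1 and NE2/3/4).  Unit `b2b-balaban-t4-ne9-formalise-leaf-05` (NE9
crux-team leaf prover, gen 67).  Imports `B11Eq143LinearTermRadii` ONLY; modifies nothing.  Net new unproved facts: 0.
-/

noncomputable section

namespace Literature.MathematicalPhysics.QuantumFieldTheory.Balaban1983to89.B11Eq143LinearTermRadiiUniform

open Metric Set
open Literature.MathematicalPhysics.QuantumFieldTheory.Balaban1983to89
open Literature.MathematicalPhysics.QuantumFieldTheory.Balaban1983to89.B13Contraction113 (QuadAnalytic)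
open Literature.MathematicalPhysics.QuantumFieldTheory.Balaban1983to89.B11Eq174Chart (Regime)

/-! ## §1 The closed-form radii: positivity and the cap -/

/-- The closed-form self-map radius `ε₄ := min (a₃∕4) (min (δ∕2) ((1 − θ)∕(16(B₀C₄ + 1))))` is positive. [folklore]
[cite: Balaban1985Variational, Prop. 6 (121) p.295] -/
theorem min3_pos {B₀ θ C₄ a₃ δ : ℝ} (hB₀ : 0 ≤ B₀) (hC₄ : 0 ≤ C₄) (ha₃ : 0 < a₃) (hθ : θ < 1) (hδ : 0 < δ) :
    0 < min (a₃ / 4) (min (δ / 2) ((1 - θ) / (16 * (B₀ * C₄ + 1)))) := by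
  have hs : 0 < 1 - θ := by linarith
  exact lt_min (by positivity) (lt_min (by positivity) (by positivity))

/-- The cap: `ε₄ + a ≤ δ` for the closed-form radii (`ε₄ ≤ δ∕2` and `a ≤ ε₄` since `1 − θ ≤ 1 ≤ 4(θ + 1)`). [folklore]
[cite: Balaban1985Variational, Prop. 6 (121) p.295] -/
theorem radiiLinear_add_le {B₀ θ C₄ a₃ δ : ℝ} (hB₀ : 0 ≤ B₀) (hC₄ : 0 ≤ C₄) (ha₃ : 0 < a₃) (hθ0 : 0 ≤ θ) (hθ : θ < 1) (hδ : 0 < δ) :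
    min (a₃ / 4) (min (δ / 2) ((1 - θ) / (16 * (B₀ * C₄ + 1)))) +
        (1 - θ) * min (a₃ / 4) (min (δ / 2) ((1 - θ) / (16 * (B₀ * C₄ + 1)))) / (4 * (θ + 1)) ≤ δ := by
  set ε₄ : ℝ := min (a₃ / 4) (min (δ / 2) ((1 - θ) / (16 * (B₀ * C₄ + 1)))) with hε₄def
  have hε₄0 : 0 < ε₄ := min3_pos hB₀ hC₄ ha₃ hθ hδ
  have hε₄δ : ε₄ ≤ δ / 2 := (min_le_right _ _).trans (min_le_left _ _)
  have haε : (1 - θ) * ε₄ / (4 * (θ + 1)) ≤ ε₄ := by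
    rw [div_le_iff₀ (by positivity)]; nlinarith
  linarith

/-! ## §2 The regime at the closed-form radii, for EVERY triple under the bounds -/

/-- **A REGIME WITH THE LINEAR TERM AT CLOSED-FORM RADII DEPENDING ON THE BOUNDS ONLY**: for numbers `B₀, C₄ ≥ 0`, `a₃, δ > 0`, `0 ≤ θ < 1`,
put `ε₄ := min (a₃∕4) (min (δ∕2) ((1 − θ)∕(16(B₀C₄ + 1))))`, `a := (1 − θ)ε₄∕(4(θ + 1))`, `j₀ := (1 − θ)ε₄∕(4(B₀ + 1))`; then for EVERY `𝒢` with
`‖𝒢f‖ ≤ B₀‖f‖`, EVERY `Λ` with `‖ΛY‖ ≤ θ‖Y‖`, EVERY `W` quadratic-analytic with `(C₄, a₃)` and every `j ≤ j₀` (the current letter's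
size; `0 ≤ j` is not needed for the scalar conditions): `Regime 𝒢 Λ W B₀ θ C₄ a₃ j a ε₄` — (118) as `B₀j + θ(ε₄ + a) + B₀C₄(ε₄ + a)² ≤ ¼sε₄ + (θε₄ + ¼sε₄) + ¼sε₄ ≤ ε₄` (`s := 1 − θ`), (121) as
`θ + 4B₀C₄(ε₄ + a) ≤ θ + s∕2 < 1`.  The arithmetic of `B11Eq143LinearTermRadii.exists_regime_radii_linear_of_le` with `B₀` a LETTER instead of `‖𝒢‖`.
[cite: Balaban1985Variational, Prop. 6 (118), (121) p.295, (143) p.300] -/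
theorem regime_linear_explicit {𝒴 𝒵 : Type*} [NormedAddCommGroup 𝒴] [NormedSpace ℂ 𝒴] [NormedAddCommGroup 𝒵] [NormedSpace ℂ 𝒵]
    {B₀ θ C₄ a₃ δ : ℝ} (hB₀ : 0 ≤ B₀) (hC₄ : 0 ≤ C₄) (ha₃ : 0 < a₃) (hθ0 : 0 ≤ θ) (hθ : θ < 1) (hδ : 0 < δ)
    (𝒢 : 𝒵 →L[ℂ] 𝒴) (Λ : 𝒴 →L[ℂ] 𝒴) {W : 𝒴 → 𝒵} (h𝒢 : ∀ f, ‖𝒢 f‖ ≤ B₀ * ‖f‖) (hΛ : ∀ Y, ‖Λ Y‖ ≤ θ * ‖Y‖)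
    (hW : QuadAnalytic W C₄ a₃) {j : ℝ}
    (hj : j ≤ (1 - θ) * min (a₃ / 4) (min (δ / 2) ((1 - θ) / (16 * (B₀ * C₄ + 1)))) / (4 * (B₀ + 1))) :
    Regime 𝒢 Λ W B₀ θ C₄ a₃ j
      ((1 - θ) * min (a₃ / 4) (min (δ / 2) ((1 - θ) / (16 * (B₀ * C₄ + 1)))) / (4 * (θ + 1)))
      (min (a₃ / 4) (min (δ / 2) ((1 - θ) / (16 * (B₀ * C₄ + 1))))) := by
  set s : ℝ := 1 - θ with hs
  have hs0 : 0 < s := by rw [hs]; linarith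
  have hs1 : s ≤ 1 := by rw [hs]; linarith
  have hK : 0 < B₀ * C₄ + 1 := by positivity
  set ε₄ : ℝ := min (a₃ / 4) (min (δ / 2) (s / (16 * (B₀ * C₄ + 1)))) with hε₄def
  have hε₄0 : 0 < ε₄ := by
    rw [hε₄def]; exact lt_min (by positivity) (lt_min (by positivity) (by positivity))
  have hε₄a : ε₄ ≤ a₃ / 4 := min_le_left _ _
  have hε₄K : ε₄ ≤ s / (16 * (B₀ * C₄ + 1)) := (min_le_right _ _).trans (min_le_right _ _)
  -- `16 B₀C₄ ε₄ ≤ s`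
  have hprod : 16 * (B₀ * C₄) * ε₄ ≤ s := by
    have h1 : 16 * (B₀ * C₄ + 1) * ε₄ ≤ s := by
      rw [le_div_iff₀ (by positivity)] at hε₄K; linarith
    nlinarith
  set a : ℝ := s * ε₄ / (4 * (θ + 1)) with ha
  have ha0 : 0 < a := by positivity
  -- `a ≤ ε₄` (since `s ≤ 1 ≤ 4(θ + 1)`), `θ·a ≤ sε₄/4`
  have haε : a ≤ ε₄ := by
    rw [ha, div_le_iff₀ (by positivity)]; nlinarith
  have hθa : θ * a ≤ s * ε₄ / 4 := by
    rw [ha, mul_div_assoc', div_le_div_iff₀ (by positivity) (by positivity)]; nlinarith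
  refine ⟨h𝒢, hΛ, hW, hB₀, hC₄, hθ0, hε₄0.le, by linarith, ?_, ?_⟩
  · -- (118) with the linear term
    have h1 : B₀ * j ≤ s * ε₄ / 4 := by
      have : B₀ * j ≤ B₀ * (s * ε₄ / (4 * (B₀ + 1))) := mul_le_mul_of_nonneg_left hj hB₀
      refine this.trans ?_
      rw [mul_div_assoc', div_le_div_iff₀ (by positivity) (by positivity)]
      nlinarith [mul_nonneg hB₀ (mul_nonneg hs0.le hε₄0.le)]
    have h2 : B₀ * C₄ * (ε₄ + a) ^ 2 ≤ s * ε₄ / 4 := by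
      have hsq : (ε₄ + a) ^ 2 ≤ 4 * ε₄ ^ 2 := by nlinarith
      have hBC : 0 ≤ B₀ * C₄ := mul_nonneg hB₀ hC₄
      calc B₀ * C₄ * (ε₄ + a) ^ 2 ≤ B₀ * C₄ * (4 * ε₄ ^ 2) := mul_le_mul_of_nonneg_left hsq hBC
        _ = (16 * (B₀ * C₄) * ε₄) * ε₄ / 4 := by ring
        _ ≤ s * ε₄ / 4 := by gcongr
    have h3 : θ * (ε₄ + a) = θ * ε₄ + θ * a := by ring
    have h4 : θ * ε₄ = ε₄ - s * ε₄ := by rw [hs]; ring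
    have h5 : 0 ≤ s * ε₄ := by positivity
    rw [h3]
    linarith [h1, h2, hθa, h4, h5]
  · -- (121) second member with `θ`
    have hBC : 0 ≤ B₀ * C₄ := mul_nonneg hB₀ hC₄
    have h5 : 4 * B₀ * C₄ * (ε₄ + a) ≤ 8 * (B₀ * C₄) * ε₄ := by nlinarith
    have h6 : θ = 1 - s := by rw [hs]; ring
    rw [h6]
    linarith [h5, hprod]

/-! ## §3 The ∃-form on fixed carriers: radii BEFORE the operators -/

/-- **`exists_regime_radii_linear_of_le` WITH ITS QUANTIFIERS COMMUTED** (fixed carriers `𝒴`, `𝒵`): for numbers `B₀, C₄ ≥ 0`, `a₃, δ > 0`,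
`0 ≤ θ < 1` there are `j₀, a, ε₄ > 0` with `ε₄ + a ≤ δ` such that EVERY `𝒢` with `‖𝒢f‖ ≤ B₀‖f‖`, EVERY `Λ` with `‖ΛY‖ ≤ θ‖Y‖` and EVERY `W`
quadratic-analytic with `(C₄, a₃)` are in `Regime 𝒢 Λ W B₀ θ C₄ a₃ j a ε₄` for all `0 ≤ j ≤ j₀` — ONE set of radii for the whole family under the
bounds (e.g. the small-field family `U ↦ (𝔊(U), −(𝔊(U) ∘L L_J))` of the NE9 chain once `B₀`, `θ` are uniform letters).  For `U`-indexed carriers use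
§2's closed form. [cite: Balaban1985Variational, Prop. 6 (118), (121) p.295, (143) p.300] -/
theorem exists_regime_radii_linear_uniform {𝒴 𝒵 : Type*} [NormedAddCommGroup 𝒴] [NormedSpace ℂ 𝒴] [NormedAddCommGroup 𝒵]
    [NormedSpace ℂ 𝒵] {B₀ θ C₄ a₃ δ : ℝ} (hB₀ : 0 ≤ B₀) (hC₄ : 0 ≤ C₄) (ha₃ : 0 < a₃) (hθ0 : 0 ≤ θ) (hθ : θ < 1) (hδ : 0 < δ) :
    ∃ j₀ a ε₄ : ℝ, 0 < j₀ ∧ 0 < a ∧ 0 < ε₄ ∧ ε₄ + a ≤ δ ∧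
      ∀ (𝒢 : 𝒵 →L[ℂ] 𝒴) (Λ : 𝒴 →L[ℂ] 𝒴) (W : 𝒴 → 𝒵), (∀ f, ‖𝒢 f‖ ≤ B₀ * ‖f‖) → (∀ Y, ‖Λ Y‖ ≤ θ * ‖Y‖) → QuadAnalytic W C₄ a₃ →
        ∀ j, 0 ≤ j → j ≤ j₀ → Regime 𝒢 Λ W B₀ θ C₄ a₃ j a ε₄ := by
  have hs0 : 0 < 1 - θ := by linarith
  have hε₄0 := min3_pos hB₀ hC₄ ha₃ hθ hδ
  exact ⟨_, _, _, by positivity, by positivity, hε₄0, radiiLinear_add_le hB₀ hC₄ ha₃ hθ0 hθ hδ,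
    fun 𝒢 Λ W h𝒢 hΛ hW j _ hj => regime_linear_explicit hB₀ hC₄ ha₃ hθ0 hθ hδ 𝒢 Λ h𝒢 hΛ hW hj⟩

end Literature.MathematicalPhysics.QuantumFieldTheory.Balaban1983to89.B11Eq143LinearTermRadiiUniform

end
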